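/-
Origin: expansion seat `prover-pub-hodgecm-mc-discharge-3-0`, handover #1 14:12Z md5 cf854e6a9240 (260 l.; RE-FROZEN r2 for binder-2's 13:57Z pin re-cut (r1 83ea98e6c1a2 was cut against ArchFactor 9d297e84b8c3); NEW additive KERNEL leaf, ns HodgeCM.Model.HypCensus; imports `HodgeCM.Model.HypCensus.ArchDatum` + `HodgeCM.Vendored.H21.NumberTheory.Weil1964.ArchWeilDatumOfCoefficients`; 0 defs, 8 theorems: `continuous_archProdHom`, `continuous_archWeilRep_apply_apply` (pointwise coefficient continuity of `archWeilRep`, hyp `hsc : Continuous (u ↦ pairSplitting s (archProdHom u))` = `(continuous_pairSplitting hs_cont).comp continuous_archProdHom`), `continuous_repTransport_archWeilRep`, `continuous_repTransport_archWeilRep_apply_apply`, `isPhaseCovariantS_repTransport_archWeilRep` (from binder-2's `archWeilRep_rhoSD` through the dictionary hyp `hγ : archPhaseMap 𝕋 e′ hTa (toSp (adelicInl (archToAdelic u.1) * adelicInr (archToAdelic u.2))) = γ (ϖ u)` — weil-2's `archPhaseMap_toSp_pair` at `(archToAdelic u.1, archToAdelic u.2)` verbatim), `continuous_uncurry_repTransport_archWeilRep`,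 `continuous_apply_repTransport_archWeilRep`, `continuous_apply_archWeilRep` = sub-item (c2) (w1) for ANY `KAKImplementerData` + continuous `ϖ` under `hγ`. 0 Prop defs, 0 records, nothing cited, MODEL-N ±0, E unchanged. EVIDENCE: hub-farm `lean check` rc 0 / 0 sorries / 0 warnings of the concatenation ArchFactor 55e596e2a0dc + ArchDatum 13e0d54cb896 + rows #1,#2 with `HodgeCM.Vendored.H21.` → tree imports (`mc/pub-hodgecm-mc-discharge-3/notes/check_ArchDatumCoeff_concat.lean`, importing p188488's built module, 47 s, 14:11Z). No private `lake` build from this seat (hub-load courtesy); `#print axioms` at the packager's CERT.) (`HOME/mc/pub-hodgecm-mc-discharge-3/stage/HodgeCM/Model/HypCensus/ArchDatumCoeff.lean`, md5 cf854e6a, 260 lines);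
landed by the gen-12 packager (p-g12) in gate run 36 as `HodgeCM/Model/HypCensus/ArchDatumCoeff.lean` (verbatim).
-/
/-
Origin: speedrun cell pub-hodgecm, MODEL-CONSTRUCTION sub-cell, discharge seat mc-discharge-3 (unit pub-hodgecm-mc-discharge-3,
seat prover-pub-hodgecm-mc-discharge-3-0), ticket D-3 = BINDER-OWNERS §1a rows 10/16/17 sub-items (c2) (w1) strong continuity
of binder-2's `archWeilRep` ((J-arch) §3(b) of BINDER-TRIAGE §50.2; (c4) (w2′) is the sequel `ArchDatumLift.lean`), 2026-08-19.
Target in PKG: `HodgeCM/Model/HypCensus/ArchDatumCoeff.lean` (NEW additive leaf next to binder-2's `ArchDatum.lean`,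
RUN 37 packet; imports `ArchDatum` + the K-1 twin of the tree engine `Weil1964/ArchWeilDatumOfCoefficients` p188198).
KERNEL only: 0 records / named facts, 0 proof holes.  Checked against the hub tree by concatenation with
`ArchFactor.lean` 55e596e2a0dc / `ArchDatum.lean` 13e0d54cb896 (imports de-vendored), farm rc 0.
-/
import Summits.HodgeConjecture.HodgeCM.Model.HypCensus.ArchDatum
import Literature.NumberTheory.Weil1964.ArchWeilDatumOfCoefficients

/-!
# Census kit (rows A12/A34), junction (J-arch) §3(b): (w1) of `archWeilRep` from coefficient continuity

`ArchFactor.lean` defines the archimedean Weil representation `archWeilRep … s hs` of `G_∞ = U(J_V)(E⊗ℝ) × U(J_W)(E⊗ℝ)`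
on `𝓢((F ⊗ ℝ)^n)` read off a splitting `s` of the GR91 dual pair (`ω_ψ(s(x_∞ ⊗ y_∞)) = archWeilRep (x,y) ⊗ 1`);
`ArchDatum.lean` §3(a) proves its EXACT Heisenberg covariance `archWeilRep_rhoSD` over the archimedean phase map
`archPhaseMap 𝕋 e′ hTa (π(s_pair(x_∞, y_∞)))` in any real frame `e′`.  This leaf supplies the strong-continuity clause (w1) of
the tree's `IsArchWeilDatum` for the transported representation `repTransport e′ (archWeilRep …)` on `𝓢(ℝ^σ)`, through
the tree engine `Weil1964/ArchWeilDatumOfCoefficients` (p188198):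

* §1 `continuous_archWeilRep_apply_apply` — the ONLY analytic input the adelic side provides: POINTWISE continuity of the
  matrix coefficients `u ↦ (archWeilRep u Φ)(a)` for `s_pair` continuous on the archimedean pair group
  (`continuous_archRepMp_apply_apply`, topology of
  `Mp_ψ(W_𝔸)`); `continuous_repTransport_archWeilRep`, `isPhaseCovariantS_repTransport_archWeilRep` (the (w2) of §3(a)
  moved to `𝓢(ℝ^σ)` and rewritten through a DICTIONARY hypothesis
  `hγ : archPhaseMap 𝕋 e′ hTa (toSp (x_∞ ⊗ 1 · 1 ⊗ y_∞)) = γ (ϖ (x,y))` — LITERALLY weil-2's `archPhaseMap_toSp_pair` at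
  `(u₁, u₂) = (archToAdelic x, archToAdelic y)`);
* §2 **(w1)** `continuous_apply_repTransport_archWeilRep` / `continuous_apply_archWeilRep`: for ANY `KAK` implementer data
  `D : KAKImplementerData γ κ a W_K W_A` on a monoid `G′` (weil-2: `kakImplementerData_leviFamily_places_reindex` of the
  per-place `LeviKAKInput`s) and continuous `ϖ : G_∞ → G′` under `hγ`, every orbit map `u ↦ archWeilRep u Φ` is
  continuous into the Fréchet space `𝓢` (indeed jointly continuous) — sub-item (c2), with NO Weil element, NO vacuum
  character and NO unitarity of `archWeilRep` used;
* (w2′) and the assembled `IsArchWeilDatum` (sub-item (c4)) are the sequel `ArchDatumLift.lean`.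

Nothing here is a claim of PerL/QW8. [Folland1989, §4.2, the Schur remark p. 156] is the provenance of the argument.
-/

set_option autoImplicit false

noncomputable section

open NumberField IsDedekindDomain MeasureTheory
open scoped Matrix
open scoped Kronecker Classical TensorProduct
open Literature.NumberTheory.Automorphic Literature.NumberTheory.Weil1964
open Literature.RepresentationTheory.HeisenbergGroup (polar Heisenberg symplecticGroup ofSymplectic)
open Literature.NumberTheory.GelbartRogawski1991
open Literature.Analysis.SegalBargmann

namespace HodgeCM.Model.HypCensus

section Pair

variable (F E : Type) [Field F] [NumberField F] [Field E] [NumberField E] [Algebra F E]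
variable (c : E ≃ₐ[F] E) (N M : ℕ) (JV : Matrix (Fin N) (Fin N) E) (JW : Matrix (Fin M) (Fin M) E)

/-! ## §1 Pointwise coefficient continuity; the transported representation -/

/-- **The archimedean pair group pushed into `U(J_V)(𝔸_F) × U(J_W)(𝔸_F)` continuously** (`continuous_archToAdelic`);
so `hsc` below is `(UnitaryDualPair.continuous_pairSplitting … hs_cont).comp (continuous_archProdHom …)` for a continuous
splitting `s` (`continuous_cmPairSplitting`). [folklore] -/
theorem continuous_archProdHom :
    Continuous (archProdHom F E c N M JV JW) :=
  (UnitaryGroup.continuous_archToAdelic F E c N JV).prodMap (UnitaryGroup.continuous_archToAdelic F E c M JW)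

/-- **Pointwise continuity of the matrix coefficients of `archWeilRep`**: for a pair splitting `s_pair` continuous on the
archimedean pair group, `u ↦ (archWeilRep u Φ)(a)` is continuous (`continuous_archRepMp_apply_apply`: the read-off is
a matrix coefficient of `ω_ψ`, continuous in the topology of `Mp_ψ(W_𝔸)`). [Weil1964, Chap. III n° 39 p. 189] -/
theorem continuous_archWeilRep_apply_apply [Algebra.IsQuadraticExtension F E] {δ : E} (hcδ : c δ = -δ) (hδ : δ ≠ 0)
    {d : F} (hd : δ * δ = algebraMap F E d) {TV : Matrix (Fin N) (Fin N) F} {TW : Matrix (Fin M) (Fin M) F}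
    (hV : TV.IsSymm) (hW : TW.IsSymm) (hVd : IsUnit TV.det) (hWd : IsUnit TW.det)
    (hJV : JV = TV.map (algebraMap F E)) (hJW : JW = TW.map (algebraMap F E))
    {n : ℕ} (e : Fin N × Fin M ≃ Fin n)
    (s : UnitaryGroup.adelicPair F E c N M JV JW →* adelicMpCont F (Fin n) (UnitaryDualPair.adelicGram F e TV TW))
    (hs : ∀ g, adelicMpCont.proj F (Fin n) (UnitaryDualPair.adelicGram F e TV TW) (s g) =
      UnitaryDualPair.toSp F E c N M e JV JW hcδ hδ hd hV hW hJV hJW g)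
    (hsc : Continuous fun u => UnitaryDualPair.pairSplitting F E c N M e JV JW s (archProdHom F E c N M JV JW u))
    (Φ : SchwartzMap (Fin n → mixedEmbedding.mixedSpace F) ℂ) (a : Fin n → mixedEmbedding.mixedSpace F) :
    Continuous fun u => archWeilRep F E c N M JV JW hcδ hδ hd hV hW hVd hWd hJV hJW e s hs u Φ a := by
  unfold archWeilRep
  exact continuous_archRepMp_apply_apply _
    ((UnitaryDualPair.pairSplitting F E c N M e JV JW s).comp (archProdHom F E c N M JV JW)) _ hsc Φ a

/-- The operators of `repTransport e′ (archWeilRep …)` are continuous on `𝓢(ℝ^σ)`. [folklore] -/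
theorem continuous_repTransport_archWeilRep [Algebra.IsQuadraticExtension F E] {δ : E} (hcδ : c δ = -δ) (hδ : δ ≠ 0)
    {d : F} (hd : δ * δ = algebraMap F E d) {TV : Matrix (Fin N) (Fin N) F} {TW : Matrix (Fin M) (Fin M) F}
    (hV : TV.IsSymm) (hW : TW.IsSymm) (hVd : IsUnit TV.det) (hWd : IsUnit TW.det)
    (hJV : JV = TV.map (algebraMap F E)) (hJW : JW = TW.map (algebraMap F E))
    {n : ℕ} (e : Fin N × Fin M ≃ Fin n)
    (s : UnitaryGroup.adelicPair F E c N M JV JW →* adelicMpCont F (Fin n) (UnitaryDualPair.adelicGram F e TV TW))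
    (hs : ∀ g, adelicMpCont.proj F (Fin n) (UnitaryDualPair.adelicGram F e TV TW) (s g) =
      UnitaryDualPair.toSp F E c N M e JV JW hcδ hδ hd hV hW hJV hJW g)
    {σ : Type} [Fintype σ] (e' : (Fin n → mixedEmbedding.mixedSpace F) ≃L[ℝ] (σ → ℝ))
    (u : UnitaryGroup.arch F E c N JV × UnitaryGroup.arch F E c M JW) :
    Continuous (repTransport e' (archWeilRep F E c N M JV JW hcδ hδ hd hV hW hVd hWd hJV hJW e s hs) u) := by
  have h : (⇑(repTransport e' (archWeilRep F E c N M JV JW hcδ hδ hd hV hW hVd hWd hJV hJW e s hs) u) :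
      SchwartzMap (σ → ℝ) ℂ → SchwartzMap (σ → ℝ) ℂ) = fun f => schwartzTransport e'
        (archWeilRep F E c N M JV JW hcδ hδ hd hV hW hVd hWd hJV hJW e s hs u ((schwartzTransport e').symm f)) :=
    funext fun f => repTransport_apply e' _ u f
  rw [h]
  exact (schwartzTransport e').continuous.comp
    ((continuous_archWeilRep F E c N M JV JW hcδ hδ hd hV hW hVd hWd hJV hJW e s hs u).comp
      (schwartzTransport e').symm.continuous)

/-- Pointwise coefficient continuity of the transported representation. [folklore] -/
theorem continuous_repTransport_archWeilRep_apply_apply [Algebra.IsQuadraticExtension F E] {δ : E} (hcδ : c δ = -δ)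
    (hδ : δ ≠ 0) {d : F} (hd : δ * δ = algebraMap F E d) {TV : Matrix (Fin N) (Fin N) F} {TW : Matrix (Fin M) (Fin M) F}
    (hV : TV.IsSymm) (hW : TW.IsSymm) (hVd : IsUnit TV.det) (hWd : IsUnit TW.det)
    (hJV : JV = TV.map (algebraMap F E)) (hJW : JW = TW.map (algebraMap F E))
    {n : ℕ} (e : Fin N × Fin M ≃ Fin n)
    (s : UnitaryGroup.adelicPair F E c N M JV JW →* adelicMpCont F (Fin n) (UnitaryDualPair.adelicGram F e TV TW))
    (hs : ∀ g, adelicMpCont.proj F (Fin n) (UnitaryDualPair.adelicGram F e TV TW) (s g) =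
      UnitaryDualPair.toSp F E c N M e JV JW hcδ hδ hd hV hW hJV hJW g)
    (hsc : Continuous fun u => UnitaryDualPair.pairSplitting F E c N M e JV JW s (archProdHom F E c N M JV JW u))
    {σ : Type} [Fintype σ] (e' : (Fin n → mixedEmbedding.mixedSpace F) ≃L[ℝ] (σ → ℝ))
    (f : SchwartzMap (σ → ℝ) ℂ) (x : σ → ℝ) :
    Continuous fun u => repTransport e' (archWeilRep F E c N M JV JW hcδ hδ hd hV hW hVd hWd hJV hJW e s hs) u f x := by
  have h : (fun u => repTransport e' (archWeilRep F E c N M JV JW hcδ hδ hd hV hW hVd hWd hJV hJW e s hs) u f x) =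
      fun u => archWeilRep F E c N M JV JW hcδ hδ hd hV hW hVd hWd hJV hJW e s hs u ((schwartzTransport e').symm f)
        (e'.symm x) := by
    funext u
    rw [repTransport_apply, schwartzTransport_apply]
  rw [h]
  exact continuous_archWeilRep_apply_apply F E c N M JV JW hcδ hδ hd hV hW hVd hWd hJV hJW e s hs hsc _ _

/-- **(w2) on `𝓢(ℝ^σ)` over a dictionary**: if the archimedean phase maps of `toSp (x_∞ ⊗ 1 · 1 ⊗ y_∞)` in the frame
`e′` are `γ (ϖ (x, y))`, the transported representation is Heisenberg-covariant over `γ ∘ ϖ` (from §3(a) `archWeilRep_rhoSD`).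
[Folland1989, Prop. (1.43)] -/
theorem isPhaseCovariantS_repTransport_archWeilRep [Algebra.IsQuadraticExtension F E] {δ : E} (hcδ : c δ = -δ)
    (hδ : δ ≠ 0) {d : F} (hd : δ * δ = algebraMap F E d) {TV : Matrix (Fin N) (Fin N) F} {TW : Matrix (Fin M) (Fin M) F}
    (hV : TV.IsSymm) (hW : TW.IsSymm) (hVd : IsUnit TV.det) (hWd : IsUnit TW.det)
    (hJV : JV = TV.map (algebraMap F E)) (hJW : JW = TW.map (algebraMap F E))
    {n : ℕ} (e : Fin N × Fin M ≃ Fin n)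
    (s : UnitaryGroup.adelicPair F E c N M JV JW →* adelicMpCont F (Fin n) (UnitaryDualPair.adelicGram F e TV TW))
    (hs : ∀ g, adelicMpCont.proj F (Fin n) (UnitaryDualPair.adelicGram F e TV TW) (s g) =
      UnitaryDualPair.toSp F E c N M e JV JW hcδ hδ hd hV hW hJV hJW g)
    {σ : Type} [Fintype σ] (e' : (Fin n → mixedEmbedding.mixedSpace F) ≃L[ℝ] (σ → ℝ))
    (hTa : IsUnit (archMat F (Fin n) (UnitaryDualPair.adelicGram F e TV TW)))
    {G' : Type*} (γ : G' → PhaseMap σ) (ϖ : UnitaryGroup.arch F E c N JV × UnitaryGroup.arch F E c M JW → G')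
    (hγ : ∀ (u : UnitaryGroup.arch F E c N JV × UnitaryGroup.arch F E c M JW) (pq : (σ → ℝ) × (σ → ℝ)),
      archPhaseMap (UnitaryDualPair.adelicGram F e TV TW) e' hTa
        (UnitaryDualPair.toSp F E c N M e JV JW hcδ hδ hd hV hW hJV hJW
          (UnitaryGroup.adelicInl F E c N M JV JW (UnitaryGroup.archToAdelic F E c N JV u.1) *
            UnitaryGroup.adelicInr F E c N M JV JW (UnitaryGroup.archToAdelic F E c M JW u.2))) pq = γ (ϖ u) pq) :
    IsPhaseCovariantS (fun u => γ (ϖ u))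
      (fun u => repTransport e' (archWeilRep F E c N M JV JW hcδ hδ hd hV hW hVd hWd hJV hJW e s hs) u) := by
  refine (isPhaseCovariantS_opTransport_iff e' (fun u => γ (ϖ u))
    (fun u => archWeilRep F E c N M JV JW hcδ hδ hd hV hW hVd hWd hJV hJW e s hs u)).2 ?_
  intro u p q Φ
  have hφ : archPhaseMap (UnitaryDualPair.adelicGram F e TV TW) e' hTa
      (adelicMpCont.proj F (Fin n) (UnitaryDualPair.adelicGram F e TV TW)
        (UnitaryDualPair.pairSplitting F E c N M e JV JW s (archProdHom F E c N M JV JW u))) = γ (ϖ u) := by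
    funext pq
    rw [UnitaryDualPair.pairSplitting_apply, hs]
    exact hγ u pq
  have h1 := archWeilRep_rhoSD F E c N M JV JW hcδ hδ hd hV hW hVd hWd hJV hJW e s hs e' hTa u p q Φ
  rw [hφ] at h1
  exact h1

/-! ## §2 (w1): strong continuity of `archWeilRep` from `KAK` implementer data over the dictionary — sub-item (c2) -/

/-- **(w1) for the transported representation, joint form**: `(u, f) ↦ repTransport e′ (archWeilRep …) u f` is
continuous `G_∞ × 𝓢(ℝ^σ) → 𝓢(ℝ^σ)`. [Folland1989, §4.2, the Schur remark p. 156] -/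
theorem continuous_uncurry_repTransport_archWeilRep [Algebra.IsQuadraticExtension F E] {δ : E} (hcδ : c δ = -δ)
    (hδ : δ ≠ 0) {d : F} (hd : δ * δ = algebraMap F E d) {TV : Matrix (Fin N) (Fin N) F} {TW : Matrix (Fin M) (Fin M) F}
    (hV : TV.IsSymm) (hW : TW.IsSymm) (hVd : IsUnit TV.det) (hWd : IsUnit TW.det)
    (hJV : JV = TV.map (algebraMap F E)) (hJW : JW = TW.map (algebraMap F E))
    {n : ℕ} (e : Fin N × Fin M ≃ Fin n)
    (s : UnitaryGroup.adelicPair F E c N M JV JW →* adelicMpCont F (Fin n) (UnitaryDualPair.adelicGram F e TV TW))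
    (hs : ∀ g, adelicMpCont.proj F (Fin n) (UnitaryDualPair.adelicGram F e TV TW) (s g) =
      UnitaryDualPair.toSp F E c N M e JV JW hcδ hδ hd hV hW hJV hJW g)
    (hsc : Continuous fun u => UnitaryDualPair.pairSplitting F E c N M e JV JW s (archProdHom F E c N M JV JW u))
    {σ : Type} [Fintype σ] [DecidableEq σ] (e' : (Fin n → mixedEmbedding.mixedSpace F) ≃L[ℝ] (σ → ℝ))
    (hTa : IsUnit (archMat F (Fin n) (UnitaryDualPair.adelicGram F e TV TW)))
    {G' : Type*} [Monoid G'] [TopologicalSpace G'] {K : Type*} [TopologicalSpace K] {P : Type*} [TopologicalSpace P]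
    {γ : G' → PhaseMap σ} {κ : K → G'} {a : P → G'} {WK : K → (SchwartzMap (σ → ℝ) ℂ →L[ℂ] SchwartzMap (σ → ℝ) ℂ)}
    {WA : P → (SchwartzMap (σ → ℝ) ℂ →L[ℂ] SchwartzMap (σ → ℝ) ℂ)} (D : KAKImplementerData γ κ a WK WA)
    (ϖ : UnitaryGroup.arch F E c N JV × UnitaryGroup.arch F E c M JW → G') (hϖ : Continuous ϖ)
    (hγ : ∀ (u : UnitaryGroup.arch F E c N JV × UnitaryGroup.arch F E c M JW) (pq : (σ → ℝ) × (σ → ℝ)),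
      archPhaseMap (UnitaryDualPair.adelicGram F e TV TW) e' hTa
        (UnitaryDualPair.toSp F E c N M e JV JW hcδ hδ hd hV hW hJV hJW
          (UnitaryGroup.adelicInl F E c N M JV JW (UnitaryGroup.archToAdelic F E c N JV u.1) *
            UnitaryGroup.adelicInr F E c N M JV JW (UnitaryGroup.archToAdelic F E c M JW u.2))) pq = γ (ϖ u) pq) :
    Continuous fun x : (UnitaryGroup.arch F E c N JV × UnitaryGroup.arch F E c M JW) × SchwartzMap (σ → ℝ) ℂ =>
      repTransport e' (archWeilRep F E c N M JV JW hcδ hδ hd hV hW hVd hWd hJV hJW e s hs) x.1 x.2 :=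
  continuous_uncurry_of_coeff D _
    (continuous_repTransport_archWeilRep F E c N M JV JW hcδ hδ hd hV hW hVd hWd hJV hJW e s hs e') ϖ hϖ
    (isPhaseCovariantS_repTransport_archWeilRep F E c N M JV JW hcδ hδ hd hV hW hVd hWd hJV hJW e s hs e' hTa γ ϖ hγ)
    (continuous_repTransport_archWeilRep_apply_apply F E c N M JV JW hcδ hδ hd hV hW hVd hWd hJV hJW e s hs hsc e')

/-- **(w1) for the transported representation**: every orbit map `u ↦ repTransport e′ (archWeilRep …) u f` is continuous
into `𝓢(ℝ^σ)`. [Folland1989, §4.2, the Schur remark p. 156] -/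
theorem continuous_apply_repTransport_archWeilRep [Algebra.IsQuadraticExtension F E] {δ : E} (hcδ : c δ = -δ)
    (hδ : δ ≠ 0) {d : F} (hd : δ * δ = algebraMap F E d) {TV : Matrix (Fin N) (Fin N) F} {TW : Matrix (Fin M) (Fin M) F}
    (hV : TV.IsSymm) (hW : TW.IsSymm) (hVd : IsUnit TV.det) (hWd : IsUnit TW.det)
    (hJV : JV = TV.map (algebraMap F E)) (hJW : JW = TW.map (algebraMap F E))
    {n : ℕ} (e : Fin N × Fin M ≃ Fin n)
    (s : UnitaryGroup.adelicPair F E c N M JV JW →* adelicMpCont F (Fin n) (UnitaryDualPair.adelicGram F e TV TW))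
    (hs : ∀ g, adelicMpCont.proj F (Fin n) (UnitaryDualPair.adelicGram F e TV TW) (s g) =
      UnitaryDualPair.toSp F E c N M e JV JW hcδ hδ hd hV hW hJV hJW g)
    (hsc : Continuous fun u => UnitaryDualPair.pairSplitting F E c N M e JV JW s (archProdHom F E c N M JV JW u))
    {σ : Type} [Fintype σ] [DecidableEq σ] (e' : (Fin n → mixedEmbedding.mixedSpace F) ≃L[ℝ] (σ → ℝ))
    (hTa : IsUnit (archMat F (Fin n) (UnitaryDualPair.adelicGram F e TV TW)))
    {G' : Type*} [Monoid G'] [TopologicalSpace G'] {K : Type*} [TopologicalSpace K] {P : Type*} [TopologicalSpace P]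
    {γ : G' → PhaseMap σ} {κ : K → G'} {a : P → G'} {WK : K → (SchwartzMap (σ → ℝ) ℂ →L[ℂ] SchwartzMap (σ → ℝ) ℂ)}
    {WA : P → (SchwartzMap (σ → ℝ) ℂ →L[ℂ] SchwartzMap (σ → ℝ) ℂ)} (D : KAKImplementerData γ κ a WK WA)
    (ϖ : UnitaryGroup.arch F E c N JV × UnitaryGroup.arch F E c M JW → G') (hϖ : Continuous ϖ)
    (hγ : ∀ (u : UnitaryGroup.arch F E c N JV × UnitaryGroup.arch F E c M JW) (pq : (σ → ℝ) × (σ → ℝ)),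
      archPhaseMap (UnitaryDualPair.adelicGram F e TV TW) e' hTa
        (UnitaryDualPair.toSp F E c N M e JV JW hcδ hδ hd hV hW hJV hJW
          (UnitaryGroup.adelicInl F E c N M JV JW (UnitaryGroup.archToAdelic F E c N JV u.1) *
            UnitaryGroup.adelicInr F E c N M JV JW (UnitaryGroup.archToAdelic F E c M JW u.2))) pq = γ (ϖ u) pq)
    (f : SchwartzMap (σ → ℝ) ℂ) :
    Continuous fun u => repTransport e' (archWeilRep F E c N M JV JW hcδ hδ hd hV hW hVd hWd hJV hJW e s hs) u f :=
  continuous_apply_of_coeff D _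
    (continuous_repTransport_archWeilRep F E c N M JV JW hcδ hδ hd hV hW hVd hWd hJV hJW e s hs e') ϖ hϖ
    (isPhaseCovariantS_repTransport_archWeilRep F E c N M JV JW hcδ hδ hd hV hW hVd hWd hJV hJW e s hs e' hTa γ ϖ hγ)
    (continuous_repTransport_archWeilRep_apply_apply F E c N M JV JW hcδ hδ hd hV hW hVd hWd hJV hJW e s hs hsc e') f

/-- **(w1) for `archWeilRep` itself** (on `𝓢((F ⊗ ℝ)^n)`): every orbit map `u ↦ archWeilRep u Φ` is continuous.
[Folland1989, §4.2, the Schur remark p. 156] -/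
theorem continuous_apply_archWeilRep [Algebra.IsQuadraticExtension F E] {δ : E} (hcδ : c δ = -δ)
    (hδ : δ ≠ 0) {d : F} (hd : δ * δ = algebraMap F E d) {TV : Matrix (Fin N) (Fin N) F} {TW : Matrix (Fin M) (Fin M) F}
    (hV : TV.IsSymm) (hW : TW.IsSymm) (hVd : IsUnit TV.det) (hWd : IsUnit TW.det)
    (hJV : JV = TV.map (algebraMap F E)) (hJW : JW = TW.map (algebraMap F E))
    {n : ℕ} (e : Fin N × Fin M ≃ Fin n)
    (s : UnitaryGroup.adelicPair F E c N M JV JW →* adelicMpCont F (Fin n) (UnitaryDualPair.adelicGram F e TV TW))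
    (hs : ∀ g, adelicMpCont.proj F (Fin n) (UnitaryDualPair.adelicGram F e TV TW) (s g) =
      UnitaryDualPair.toSp F E c N M e JV JW hcδ hδ hd hV hW hJV hJW g)
    (hsc : Continuous fun u => UnitaryDualPair.pairSplitting F E c N M e JV JW s (archProdHom F E c N M JV JW u))
    {σ : Type} [Fintype σ] [DecidableEq σ] (e' : (Fin n → mixedEmbedding.mixedSpace F) ≃L[ℝ] (σ → ℝ))
    (hTa : IsUnit (archMat F (Fin n) (UnitaryDualPair.adelicGram F e TV TW)))
    {G' : Type*} [Monoid G'] [TopologicalSpace G'] {K : Type*} [TopologicalSpace K] {P : Type*} [TopologicalSpace P]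
    {γ : G' → PhaseMap σ} {κ : K → G'} {a : P → G'} {WK : K → (SchwartzMap (σ → ℝ) ℂ →L[ℂ] SchwartzMap (σ → ℝ) ℂ)}
    {WA : P → (SchwartzMap (σ → ℝ) ℂ →L[ℂ] SchwartzMap (σ → ℝ) ℂ)} (D : KAKImplementerData γ κ a WK WA)
    (ϖ : UnitaryGroup.arch F E c N JV × UnitaryGroup.arch F E c M JW → G') (hϖ : Continuous ϖ)
    (hγ : ∀ (u : UnitaryGroup.arch F E c N JV × UnitaryGroup.arch F E c M JW) (pq : (σ → ℝ) × (σ → ℝ)),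
      archPhaseMap (UnitaryDualPair.adelicGram F e TV TW) e' hTa
        (UnitaryDualPair.toSp F E c N M e JV JW hcδ hδ hd hV hW hJV hJW
          (UnitaryGroup.adelicInl F E c N M JV JW (UnitaryGroup.archToAdelic F E c N JV u.1) *
            UnitaryGroup.adelicInr F E c N M JV JW (UnitaryGroup.archToAdelic F E c M JW u.2))) pq = γ (ϖ u) pq)
    (Φ : SchwartzMap (Fin n → mixedEmbedding.mixedSpace F) ℂ) :
    Continuous fun u => archWeilRep F E c N M JV JW hcδ hδ hd hV hW hVd hWd hJV hJW e s hs u Φ := by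
  have h : (fun u => archWeilRep F E c N M JV JW hcδ hδ hd hV hW hVd hWd hJV hJW e s hs u Φ) = fun u =>
      (schwartzTransport e').symm (repTransport e' (archWeilRep F E c N M JV JW hcδ hδ hd hV hW hVd hWd hJV hJW e s hs) u
        (schwartzTransport e' Φ)) := by
    funext u
    rw [repTransport_apply, ContinuousLinearEquiv.symm_apply_apply, ContinuousLinearEquiv.symm_apply_apply]
  rw [h]
  exact (schwartzTransport e').symm.continuous.comp
    (continuous_apply_repTransport_archWeilRep F E c N M JV JW hcδ hδ hd hV hW hVd hWd hJV hJW e s hs hsc e' hTa D ϖ hϖ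
      hγ _)

end Pair

end HodgeCM.Model.HypCensus

end
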